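import Mathlib
import Summits.Ventures.HodgeRepro.Tier4.Target
import Summits.Ventures.HodgeRepro.Tier4.Line3.Defs
import Summits.Ventures.HodgeRepro.Tier4.Line3.DefsLemmas
import Summits.Ventures.HodgeRepro.Tier4.Line3.GaussRatioFormula
import Summits.Ventures.HodgeRepro.Tier4.Line3.CopyWeightGaussian
import Summits.Ventures.HodgeRepro.Tier4.Line3.ShrinkMajGauss
import Summits.Ventures.HodgeRepro.Tier4.Line3.QuarticProfile

/-!
# Tier4/Line3/ProfileQuad — on a windowed centre the profile exponent dominates a quadratic form in the embeddings

Blind re-derivation cell `pub-hodge-repro`, Tier 4 «PROVE THE STEP», LINE L3, seat t4-L3-p2 (g3): C-L3-QUAD (STATUS S14913),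
the window ⇒ `hquad` bridge that the weighted copy-count display (x2's C-L3-WEIGHT, v0.59) binds by name.

On a centre in the near-equal profile window of width `κ` (at every slot some `a_j > 0` with `a_j ≤ tauSize/2 ≤ (1 + κ) a_j`
and `a_j ≤ defQuad σ ≤ (1 + κ) a_j` at the definite embeddings) the profile exponent of ANY tuple `ε` (CopyWeightGaussian
`profileExc_eq`: `Σ_j [(‖τ₀ ε_j‖² − 1) tauSize_j + Σ_{σ ∈ defEmb} (‖σ ε_j‖² − 1) defQuad_σ]`) is bounded below by
`windowFloor κ xm · Σ_j Σ_σ ‖σ ε_j‖² − b₀`: each slot term is `≥ a_j (2 ‖τ₀ ε_j‖² + Σ_{defEmb} ‖σ ε_j‖²) − (1 + κ) a_j (2 + card defEmb)`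
(coefficient `≥ a_j` on every non-negative square, `≤ (1 + κ) a_j` on every `−1`), and `2 ‖τ₀ ε_j‖² + Σ_{defEmb} ‖σ ε_j‖²` is the
sum over ALL embeddings (`univ = {τ₀, τ̄₀} ⊔ defEmb`, `norm_conjEmb_apply`). `windowFloor κ xm` is the smallest slot floor
`(min_j tauSize_j/2)/(1 + κ) ≤ a_j`, and `b₀ := (1 + κ)(2 + card defEmb) Σ_j tauSize_j/2`.

Nothing here says anything about the status of the Hodge conjecture for CM abelian varieties, which is NOT proved
(HC_CM is NOT proved by anyone in this repository).
-/

set_option autoImplicit false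

noncomputable section

namespace Summit.Ventures.HodgeRepro.Tier4.Line3

open Summit.Ventures.HodgeRepro.Tier4
open NumberField
open scoped ComplexConjugate
open scoped Classical

namespace T4Data

variable (X : T4Data)

/-- **THE WINDOW FLOOR** of a centre at width `κ`: the smallest half `τ₀`-size of the four slots, divided by `1 + κ`. -/
def windowFloor (κ : ℝ) (xm : X.Tuple) : ℝ :=
  (min (min (X.tauSize (xm 0) / 2) (X.tauSize (xm 1) / 2)) (min (X.tauSize (xm 2) / 2) (X.tauSize (xm 3) / 2))) / (1 + κ)

/-- The window floor is below every slot's window constant `a_j` (from `tauSize (xm j) / 2 ≤ (1 + κ) a_j`). -/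
theorem windowFloor_le {κ : ℝ} (hκ : 0 ≤ κ) {xm : X.Tuple} {a : Fin 4 → ℝ}
    (ha : ∀ j, X.tauSize (xm j) / 2 ≤ (1 + κ) * a j) (j : Fin 4) : X.windowFloor κ xm ≤ a j := by
  have hκ' : 0 < 1 + κ := by linarith
  unfold windowFloor
  rw [div_le_iff₀ hκ']
  have hmin : (min (min (X.tauSize (xm 0) / 2) (X.tauSize (xm 1) / 2))
      (min (X.tauSize (xm 2) / 2) (X.tauSize (xm 3) / 2))) ≤ X.tauSize (xm j) / 2 := by
    match j with
    | 0 => exact le_trans (min_le_left _ _) (min_le_left _ _)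
    | 1 => exact le_trans (min_le_left _ _) (min_le_right _ _)
    | 2 => exact le_trans (min_le_right _ _) (min_le_left _ _)
    | 3 => exact le_trans (min_le_right _ _) (min_le_right _ _)
  calc _ ≤ X.tauSize (xm j) / 2 := hmin
    _ ≤ (1 + κ) * a j := ha j
    _ = a j * (1 + κ) := mul_comm _ _

/-- The window floor of a windowed centre is positive. -/
theorem windowFloor_pos {κ : ℝ} (hκ : 0 ≤ κ) {xm : X.Tuple}
    (hW : ∀ j, ∃ a : ℝ, 0 < a ∧ a ≤ X.tauSize (xm j) / 2 ∧ X.tauSize (xm j) / 2 ≤ (1 + κ) * a ∧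
      ∀ σ ∈ X.defEmb, a ≤ X.defQuad σ (xm j) ∧ X.defQuad σ (xm j) ≤ (1 + κ) * a) :
    0 < X.windowFloor κ xm := by
  have hκ' : 0 < 1 + κ := by linarith
  have hpos : ∀ j, 0 < X.tauSize (xm j) / 2 := fun j => by
    obtain ⟨a, ha0, ha1, -, -⟩ := hW j
    linarith
  unfold windowFloor
  apply div_pos _ hκ'
  exact lt_min (lt_min (hpos 0) (hpos 1)) (lt_min (hpos 2) (hpos 3))

/-- The sum of `‖σ y‖²` over ALL embeddings is `2 ‖τ₀ y‖² + Σ_{σ ∈ defEmb} ‖σ y‖²`. -/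
theorem sum_norm_sq_emb_eq (y : X.E) :
    ∑ σ : X.E →+* ℂ, ‖σ y‖ ^ 2 = 2 * ‖X.τ₀ y‖ ^ 2 + ∑ σ ∈ X.defEmb, ‖σ y‖ ^ 2 := by
  rw [← Finset.sum_filter_add_sum_filter_not Finset.univ
    (fun σ : X.E →+* ℂ => σ ≠ X.τ₀ ∧ σ ≠ conjEmb X.τ₀), X.filter_not_def_eq, Finset.sum_pair X.tau_ne_conjEmb,
    X.norm_conjEmb_apply]
  unfold defEmb
  ring

/-- **ONE SLOT**: on a windowed slot the slot term of the profile exponent is bounded below by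
`a (Σ_σ ‖σ y‖²) − (1 + κ) a (2 + card defEmb)` for every `y`. -/
theorem slot_term_ge {κ : ℝ} {x : Fin 3 → X.E} {a : ℝ} (ha1 : a ≤ X.tauSize x / 2)
    (ha2 : X.tauSize x / 2 ≤ (1 + κ) * a)
    (hdef : ∀ σ ∈ X.defEmb, a ≤ X.defQuad σ x ∧ X.defQuad σ x ≤ (1 + κ) * a) (y : X.E) :
    a * (∑ σ : X.E →+* ℂ, ‖σ y‖ ^ 2) - (1 + κ) * a * (2 + X.defEmb.card) ≤
      (‖X.τ₀ y‖ ^ 2 - 1) * X.tauSize x +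
        ∑ σ ∈ Finset.univ.filter (fun σ : X.E →+* ℂ => σ ≠ X.τ₀ ∧ σ ≠ conjEmb X.τ₀),
          (‖σ y‖ ^ 2 - 1) * X.defQuad σ x := by
  have hfilt : (Finset.univ.filter (fun σ : X.E →+* ℂ => σ ≠ X.τ₀ ∧ σ ≠ conjEmb X.τ₀)) = X.defEmb := rfl
  rw [hfilt, X.sum_norm_sq_emb_eq]
  -- the `τ₀`-term
  have hτ : a * (2 * ‖X.τ₀ y‖ ^ 2) - (1 + κ) * a * 2 ≤ (‖X.τ₀ y‖ ^ 2 - 1) * X.tauSize x := by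
    have h1 : 0 ≤ ‖X.τ₀ y‖ ^ 2 := by positivity
    nlinarith
  -- the definite terms, termwise
  have hσ : ∀ σ ∈ X.defEmb, a * ‖σ y‖ ^ 2 - (1 + κ) * a ≤ (‖σ y‖ ^ 2 - 1) * X.defQuad σ x := by
    intro σ hσ
    obtain ⟨h1, h2⟩ := hdef σ hσ
    have h3 : 0 ≤ ‖σ y‖ ^ 2 := by positivity
    nlinarith
  have hsum : ∑ σ ∈ X.defEmb, (a * ‖σ y‖ ^ 2 - (1 + κ) * a) ≤ ∑ σ ∈ X.defEmb, (‖σ y‖ ^ 2 - 1) * X.defQuad σ x :=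
    Finset.sum_le_sum hσ
  have hsum' : ∑ σ ∈ X.defEmb, (a * ‖σ y‖ ^ 2 - (1 + κ) * a) =
      a * ∑ σ ∈ X.defEmb, ‖σ y‖ ^ 2 - (1 + κ) * a * X.defEmb.card := by
    rw [Finset.sum_sub_distrib, Finset.mul_sum, Finset.sum_const, nsmul_eq_mul]
    ring
  rw [hsum'] at hsum
  nlinarith [hτ, hsum]

/-- **C-L3-QUAD**: on a centre in the near-equal profile window of width `κ` the profile exponent of EVERY tuple `ε`
dominates `windowFloor κ xm · Σ_j Σ_σ ‖σ ε_j‖² − b₀` for a constant `b₀` of the centre. -/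
theorem profileExc_quad_of_window {κ : ℝ} (hκ : 0 ≤ κ) {xm : X.Tuple}
    (hW : ∀ j, ∃ a : ℝ, 0 < a ∧ a ≤ X.tauSize (xm j) / 2 ∧ X.tauSize (xm j) / 2 ≤ (1 + κ) * a ∧
      ∀ σ ∈ X.defEmb, a ≤ X.defQuad σ (xm j) ∧ X.defQuad σ (xm j) ≤ (1 + κ) * a) :
    ∃ b₀ : ℝ, ∀ ε : Fin 4 → X.E,
      X.windowFloor κ xm * (∑ j, ∑ σ : X.E →+* ℂ, ‖σ (ε j)‖ ^ 2) - b₀ ≤ X.profileExc ε xm := by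
  choose a ha0 ha1 ha2 hdef using hW
  refine ⟨(1 + κ) * (2 + X.defEmb.card) * ∑ j, X.tauSize (xm j) / 2, fun ε => ?_⟩
  rw [X.profileExc_eq]
  have hfloor : ∀ j, X.windowFloor κ xm ≤ a j := X.windowFloor_le hκ ha2
  have hslot : ∀ j, X.windowFloor κ xm * (∑ σ : X.E →+* ℂ, ‖σ (ε j)‖ ^ 2) -
      (1 + κ) * (2 + X.defEmb.card) * (X.tauSize (xm j) / 2) ≤
      (‖X.τ₀ (ε j)‖ ^ 2 - 1) * X.tauSize (xm j) +
        ∑ σ ∈ Finset.univ.filter (fun σ : X.E →+* ℂ => σ ≠ X.τ₀ ∧ σ ≠ conjEmb X.τ₀),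
          (‖σ (ε j)‖ ^ 2 - 1) * X.defQuad σ (xm j) := by
    intro j
    have h := X.slot_term_ge (ha1 j) (ha2 j) (hdef j) (ε j)
    have hS : 0 ≤ ∑ σ : X.E →+* ℂ, ‖σ (ε j)‖ ^ 2 := Finset.sum_nonneg fun σ _ => by positivity
    have hcard : (0 : ℝ) ≤ 2 + X.defEmb.card := by positivity
    have h1 : X.windowFloor κ xm * (∑ σ : X.E →+* ℂ, ‖σ (ε j)‖ ^ 2) ≤ a j * (∑ σ : X.E →+* ℂ, ‖σ (ε j)‖ ^ 2) :=
      mul_le_mul_of_nonneg_right (hfloor j) hS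
    have h2 : (1 + κ) * a j * (2 + X.defEmb.card) ≤ (1 + κ) * (2 + X.defEmb.card) * (X.tauSize (xm j) / 2) := by
      have : 0 ≤ (1 + κ) * (2 + X.defEmb.card) := by positivity
      calc (1 + κ) * a j * (2 + X.defEmb.card) = (1 + κ) * (2 + X.defEmb.card) * a j := by ring
        _ ≤ (1 + κ) * (2 + X.defEmb.card) * (X.tauSize (xm j) / 2) :=
          mul_le_mul_of_nonneg_left (ha1 j) this
    linarith
  calc X.windowFloor κ xm * (∑ j, ∑ σ : X.E →+* ℂ, ‖σ (ε j)‖ ^ 2) -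
        (1 + κ) * (2 + X.defEmb.card) * ∑ j, X.tauSize (xm j) / 2
      = ∑ j, (X.windowFloor κ xm * (∑ σ : X.E →+* ℂ, ‖σ (ε j)‖ ^ 2) -
          (1 + κ) * (2 + X.defEmb.card) * (X.tauSize (xm j) / 2)) := by
        rw [Finset.sum_sub_distrib, Finset.mul_sum, Finset.mul_sum]
    _ ≤ _ := Finset.sum_le_sum fun j _ => hslot j

end T4Data

end Summit.Ventures.HodgeRepro.Tier4.Line3

end
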